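import Summits.QuantumFields.YangMills.Theorems.BalabanUVNodesPortS1Sect5RowsNumerics
import Summits.QuantumFields.YangMills.Theorems.BalabanUVNodesPortS1Sect5Schur

/-!
# NODE O port, row PT-A-2 — [Balaban1987RG1] §5 (and (4.14), (4.32)–(4.33)) AT THE RE-CENTRED RECORD IN ONE PLACE: the finite-volume rows (4.14) `Df(0) = 0`, (5.4)∕(5.8)₁
# translation two-point + the window reading «Π(z, 0) = Π(0, −z)» (lens-1 RowA5), (A4) colour isotropy (RowA4), and the limiting-kernel rows (5.6)–(5.9) of `recordPlimAx`, ALL FROM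
# ONE SET OF ROWS — [B11] Thm 1 on the domains · (F7a) · (F7a-supp) · (I19) · numerics · `PolLimitExists` · `C²` at `0` (nestings discharged by FILE `…Sect5RowsNumerics`)

CITATION HEADER.  [I] = [Balaban1987RG1]: (4.14) p. 284, (4.32)–(4.33) p. 289, (1.20)–(1.22) p. 264, (5.2)–(5.9) pp. 292–293; [B11] = [Balaban1985Variational] Thm 1 p. 279; [B7] =
[Balaban1985Averaging] Prop. 2 (53) p. 26.  Porter PT-A-2 (`ymgap-nodeO-port-PTA-2`), `--supports stmt-QuantumFields-27930 --as helper`.  REUSED BY NAME: the PT-A-2 §5 files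
`…Sect5{KernelSymmetry, ChartSymmetry, GaugeOn, EuclOnAx, PermOnAx, GlobalRot, Schur, WardChartCalc, WardChart, Ward, Beta, RowsNumerics}`.
WHAT IS PROVED (0 sorry, 0 def).
* §1 finite volume from the rows at ONE volume `K`: `fderiv_recordTermsAx_eq_zero_of_local` ((4.14) for the record's chart from `𝓝_{k+1}(W^w) = 𝓝_{k+1}(W)` on the small fields),
  `polScalar_recordTermsAx_translate_of_local` ((5.4) two-point translation), `recordPvolAx_eq_polScalar_zero_neg` (RowA5 window reading `Π(z, 0) = Π(0, −z)`).
* §2 ★★★ `sect5_recordPlimAx_of_rows₂` — the CONJUNCTION at the record from the reduced rows: `IndexSymmetric ∧ PermCovariant ∧ ReflCovariant ∧ WardFirst` for `recordPlimAx F a₀ ε₂₉ k v`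
  ((5.6)–(5.9)), and for all large `K`: (4.14) `D(expChart)(0) = 0`, (A4) `Π^{ab} = 0` for `a ≠ b` and `Π^{aa} = Π`, (5.4) translation of the two-point kernel.
HONEST FRAMING.  Bookkeeping over displayed rows; nothing of Bałaban's estimates asserted, ported or discharged; 27930 signed-open (⁸-Ax-LR4), no claim held; finite 𝕋⁴ at fixed ε —
NOT continuum∕OS∕Clay; the Yang–Mills mass gap is NOT proved by any of this.
-/

noncomputable section

open scoped Matrix.Norms.L2Operator Topology

namespace Summit.QuantumFields.YangMills.Theorems.BalabanUVNodesPortS1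

open Filter MeasureTheory
open Literature.MathematicalPhysics.QuantumFieldTheory.Balaban1983to89
open Literature.MathematicalPhysics.QuantumFieldTheory.Balaban1983to89.Node00
open Literature.MathematicalPhysics.QuantumFieldTheory.Balaban1983to89.ExpMeanLog (deltaSU)
open Literature.MathematicalPhysics.QuantumFieldTheory.GawedzkiKupiainen1985.PeriodicGleason (unitVec)
open T4Continuum (T4Family)
open Summit.QuantumFields.YangMills.Theorems.K0RecordFormatNames
open B12PolarizationTensor120 (expChart polComp)
open B12Transverse536 (WardFirst ReflCovariant)
open Beta.PolarizationSign (IndexSymmetric)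
open FederbushMean (deltaFed)
open GaugeField (gaugeAct)

variable (F : T4Family) (a₀ ε₂₉ : ℝ)

/-! ## §1 Finite volume at the record from the on-domain invariance of `𝓝_{k+1}` -/

/-- **(4.14) `D(𝓝_{k+1} ∘ chart)(0) = 0` AT THE RECORD, VOLUME `K`** (p. 284 «first, very important consequence of the gauge invariance»): from `𝓝_{k+1}(W^w) = 𝓝_{k+1}(W)` for all lattice gauge
transformations `w` and all `ε₁`-small `W`, and differentiability of the chart at `0` (FILE `…Sect5WardChartCalc.fderiv_eq_zero_of_chartGaugeInvariant` at `ρ₈`).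
[cite: Balaban1987RG1, (4.14) p.284, (4.7) p.283, (1.19) p.263] -/
theorem fderiv_recordTermsAx_eq_zero_of_local (k : ℕ) (v : Fin (k + 1) → ℝ) (K : ℕ) {ε₁ : ℝ} (hε₁ : 0 < ε₁)
    (hd : letI θ := thetaFill F a₀ ε₂₉
      letI := θ.instVβ₁; letI := θ.instVβ₂
      DifferentiableAt ℝ (expChart (recordTermsAx F a₀ ε₂₉ k v K) θ.ρ8) 0)
    (hN : letI θ := thetaFill F a₀ ε₂₉
      ∀ (w : GaugeTransf (F.P K) (k + 1) (SU 2)) (W : GaugeField (F.P K) (k + 1) (SU 2)), PlaqSmall ε₁ W →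
        mergedTermT F 2 (TβOfRecord₁₃ F 2) (chiβOfRecord₁₃Ax F 2 θ) θ.εbg K (T4FlagMemory.extd v) k (gaugeAct w W) =
          mergedTermT F 2 (TβOfRecord₁₃ F 2) (chiβOfRecord₁₃Ax F 2 θ) θ.εbg K (T4FlagMemory.extd v) k W) :
    letI θ := thetaFill F a₀ ε₂₉
    letI := θ.instVβ₁; letI := θ.instVβ₂
    fderiv ℝ (expChart (recordTermsAx F a₀ ε₂₉ k v K) θ.ρ8) 0 = 0 := by
  letI θ := thetaFill F a₀ ε₂₉; letI := θ.instVβ₁; letI := θ.instVβ₂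
  have hρ : (θ.ρ8 : θ.Vβ → MatA 2) = (suChartMap 2 : (Fin (suChartDim 2) → ℝ) → MatA 2) := rfl
  have hinj : Function.Injective θ.ρ8 := fun a b h => suChartMap_injective 2 (by rw [← congrFun hρ a, ← congrFun hρ b]; exact h)
  refine fderiv_eq_zero_of_chartGaugeInvariant (n := Fin 2) θ.ρ8 hinj (fun a => by rw [congrFun hρ a]; exact suChartMap_mem 2 a)
    (fun X h1 h2 => by obtain ⟨a, ha⟩ := suChartMap_onto 2 X h1 h2; exact ⟨a, by rw [congrFun hρ a]; exact ha⟩) hd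
    (fun ν => siteOfInt F K (k + 1) (unitVec (Fin.cast (F.P_d K) ν))) fun lam' => ?_
  filter_upwards [eventually_plaqSmall_unitField F a₀ ε₂₉ k K hε₁] with B hB t B' hrel
  obtain ⟨w, hW⟩ := unitField_chart_gaugeAct F a₀ ε₂₉ k K lam' t B B' hrel
  show mergedTermT F 2 (TβOfRecord₁₃ F 2) (chiβOfRecord₁₃Ax F 2 θ) θ.εbg K (T4FlagMemory.extd v) k (unitField F θ k K B') =
    mergedTermT F 2 (TβOfRecord₁₃ F 2) (chiβOfRecord₁₃Ax F 2 θ) θ.εbg K (T4FlagMemory.extd v) k (unitField F θ k K B)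
  rw [hW]
  exact hN _ _ hB

/-- **(5.4) FOR THE TRANSLATIONS, TWO-POINT, AT THE RECORD, VOLUME `K`**: `Π_{μν}(x + a, y + a) = Π_{μν}(x, y)` for def-B's scalar kernel of the record's chart, from
`𝓝_{k+1}(τ_a W) = 𝓝_{k+1}(W)` on the `ε₁`-small fields (`…Sect5KernelSymmetry.polScalar_translate_of_local` + the chart face). [cite: Balaban1987RG1, (5.2)-(5.4) p.292, (1.21) p.264] -/
theorem polScalar_recordTermsAx_translate_of_local (k : ℕ) (v : Fin (k + 1) → ℝ) (K : ℕ) {ε₁ : ℝ} (hε₁ : 0 < ε₁)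
    (hN : letI θ := thetaFill F a₀ ε₂₉
      ∀ (a : Site (F.P K) (k + 1)) (W : GaugeField (F.P K) (k + 1) (SU 2)), PlaqSmall ε₁ W →
        mergedTermT F 2 (TβOfRecord₁₃ F 2) (chiβOfRecord₁₃Ax F 2 θ) θ.εbg K (T4FlagMemory.extd v) k (W.translate a) =
          mergedTermT F 2 (TβOfRecord₁₃ F 2) (chiβOfRecord₁₃Ax F 2 θ) θ.εbg K (T4FlagMemory.extd v) k W)
    (μ : Fin (F.P K).d) (x : Site (F.P K) (k + 1)) (ν : Fin (F.P K).d) (y a : Site (F.P K) (k + 1)) :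
    letI θ := thetaFill F a₀ ε₂₉
    letI := θ.instVβ₁; letI := θ.instVβ₂; letI := θ.instιβ
    polScalar (recordTermsAx F a₀ ε₂₉ k v K) θ.ρ8 θ.bV μ (x + a) ν (y + a) = polScalar (recordTermsAx F a₀ ε₂₉ k v K) θ.ρ8 θ.bV μ x ν y := by
  letI θ := thetaFill F a₀ ε₂₉; letI := θ.instVβ₁; letI := θ.instVβ₂; letI := θ.instιβ
  exact polScalar_translate_of_local (recordTermsAx F a₀ ε₂₉ k v K) θ.ρ8 θ.bV
    (fun a' => expChart_recordTermsAx_eventuallyEq_of a₀ ε₂₉ k v K _ (recordΦfAx_translate_eventuallyEq a₀ ε₂₉ k v K hε₁ a' fun W hW => hN a' W hW)) μ x ν y a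

/-- **lens-1's RowA5 «window translation `Π(z, 0) = Π(0, −z)`» AT THE RECORD, VOLUME `K`**: the finite-volume (1.21) kernel `recordPvolAx … K μ ν z = Π_{μν}(x_z, 0)` equals `Π_{μν}(0, x_{−z})`,
from the two-point translation invariance. [cite: Balaban1987RG1, (1.21) p.264 («Π(x − y)»), (5.4) p.292] -/
theorem recordPvolAx_eq_polScalar_zero_neg (k : ℕ) (v : Fin (k + 1) → ℝ) (K : ℕ) {ε₁ : ℝ} (hε₁ : 0 < ε₁)
    (hN : letI θ := thetaFill F a₀ ε₂₉
      ∀ (a : Site (F.P K) (k + 1)) (W : GaugeField (F.P K) (k + 1) (SU 2)), PlaqSmall ε₁ W →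
        mergedTermT F 2 (TβOfRecord₁₃ F 2) (chiβOfRecord₁₃Ax F 2 θ) θ.εbg K (T4FlagMemory.extd v) k (W.translate a) =
          mergedTermT F 2 (TβOfRecord₁₃ F 2) (chiβOfRecord₁₃Ax F 2 θ) θ.εbg K (T4FlagMemory.extd v) k W)
    (μ ν : Fin 4) (z : Fin 4 → ℤ) :
    letI θ := thetaFill F a₀ ε₂₉
    letI := θ.instVβ₁; letI := θ.instVβ₂; letI := θ.instιβ
    recordPvolAx F a₀ ε₂₉ k v K μ ν z =
      polScalar (recordTermsAx F a₀ ε₂₉ k v K) θ.ρ8 θ.bV (Fin.cast (F.P_d K).symm μ) 0 (Fin.cast (F.P_d K).symm ν) (siteOfInt F K (k + 1) (-z)) := by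
  letI θ := thetaFill F a₀ ε₂₉; letI := θ.instVβ₁; letI := θ.instVβ₂; letI := θ.instιβ
  show polScalar (recordTermsAx F a₀ ε₂₉ k v K) θ.ρ8 θ.bV (Fin.cast (F.P_d K).symm μ) (siteOfInt F K (k + 1) z) (Fin.cast (F.P_d K).symm ν) (siteOfInt F K (k + 1) 0) = _
  have h := polScalar_recordTermsAx_translate_of_local F a₀ ε₂₉ k v K hε₁ hN (Fin.cast (F.P_d K).symm μ) 0 (Fin.cast (F.P_d K).symm ν)
    (siteOfInt F K (k + 1) (-z)) (siteOfInt F K (k + 1) z)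
  rw [zero_add, ← siteOfInt_add F K (k + 1), neg_add_cancel] at h
  exact h

/-! ## §2 The conjunction at the record from the reduced rows -/

/-- **★★★ [I] §5 (with (4.14) and (A4)) AT THE RE-CENTRED RECORD FROM ONE SET OF ROWS**: with `θ := thetaFill F a₀ ε₂₉`, `g := extd v`, assume `0 < θ.ν.ε₀`, `0 < θ.ν.εreg`,
`0 < θ.εbg`, the limit (1.21) exists, and for all large `K`: the chart is `C²` at `0`, `k + 1 ≤ K`, the NUMERICS, [B11] Thm 1 on the domains (radius `ν.εreg`, levels `≤ k+1`) and
at radius `θ.εbg` on `domAlt_{k+1}`, (F7a), (F7a-supp), (I19).  THEN: (5.8)₂ `IndexSymmetric`, (5.6) `PermCovariant`, (5.7) `ReflCovariant` and (5.9)₁ `WardFirst` hold for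
`recordPlimAx F a₀ ε₂₉ k v`; and for all large `K`: (4.14) `D(expChart)(0) = 0`, (A4) `Π^{ab}_{μν}(x,y) = 0` (`a ≠ b`) and `Π^{aa}_{μν}(x,y) = Π_{μν}(x,y)`, (5.4) `Π_{μν}(x+a, y+a) = Π_{μν}(x, y)`.
[cite: Balaban1987RG1, (4.14) p.284, (4.32)-(4.33) p.289, (1.20)-(1.21) p.264, (5.2)-(5.9) pp.292-293; Balaban1985Variational, Thm 1 p.279; Balaban1985Averaging, Prop. 2 (53) p.26] -/
theorem sect5_recordPlimAx_of_rows₂ (k : ℕ) (v : Fin (k + 1) → ℝ)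
    (hε₀ : 0 < (thetaFill F a₀ ε₂₉).ν.ε₀) (hεreg : 0 < (thetaFill F a₀ ε₂₉).ν.εreg) (hεbg : 0 < (thetaFill F a₀ ε₂₉).εbg)
    (hlim : letI θ := thetaFill F a₀ ε₂₉
      letI := θ.instVβ₁; letI := θ.instVβ₂; letI := θ.instιβ
      PolLimitExists F (k + 1) (fun K => recordTermsAx F a₀ ε₂₉ k v K) θ.ρ8 θ.bV)
    (hC2 : letI θ := thetaFill F a₀ ε₂₉
      letI := θ.instVβ₁; letI := θ.instVβ₂
      ∀ᶠ K in atTop, ContDiffAt ℝ 2 (expChart (recordTermsAx F a₀ ε₂₉ k v K) θ.ρ8) 0)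
    (hrows : letI θ := thetaFill F a₀ ε₂₉
      ∀ᶠ K in atTop, k + 1 ≤ K ∧
        (((((F.P K).d * (F.P K).L : ℕ) : ℝ)) ^ 2 / 4 * θ.ν.ε₀ < deltaFed (Fin 2) ∧
          (143 * (((((F.P K).d + 4 : ℕ) : ℝ)) ^ 2 / 4) ^ 2) * θ.ν.εreg ≤ 1 / 3 ∧
          2 * θ.ν.εreg ≤ 2 * deltaSU (Fin 2) / ((((F.P K).d + 4) * (F.P K).L : ℕ) : ℝ) ^ 2 ∧ 2 * θ.ν.εreg ≤ θ.ν.ε₀ * ((F.P K).L : ℝ) ^ 2 ∧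
          (143 * (((((F.P K).d + 4 : ℕ) : ℝ)) ^ 2 / 4) ^ 2) * θ.εbg ≤ 1 / 3 ∧
          2 * θ.εbg ≤ 2 * deltaSU (Fin 2) / ((((F.P K).d + 4) * (F.P K).L : ℕ) : ℝ) ^ 2 ∧ 2 * θ.εbg ≤ θ.ν.ε₀ * ((F.P K).L : ℝ) ^ 2) ∧
        (∀ j < k + 1, ∀ W ∈ domAltOfRecord F 2 θ.ν K (j + 1), UkExists F 2 K (j + 1) θ.ν.εreg W ∧ UniqueUkOrbit F 2 K (j + 1) θ.ν.εreg W) ∧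
        (∀ j < k + 1, domAltOfRecord F 2 θ.ν K (j + 1) ⊆
          regSetOfRecord F 2 K j (betaInputOfRecord F 2 (TβOfRecord₁₃ F 2) (chiβOfRecord₁₃Ax F 2 θ) K (T4FlagMemory.extd v) j)) ∧
        (∀ j < k + 1, ∀ᵐ U ∂(fieldMeasure (F.P K) j (SU 2)), (avOfRecord F 2 K j).avg U ∈ domAltOfRecord F 2 θ.ν K (j + 1) →
          U ∉ domAltOfRecord F 2 θ.ν K j → chiβOfRecord₁₃Ax F 2 θ K (T4FlagMemory.extd v) j U = 0) ∧
        (∀ j < k + 1, Integrable (betaInputOfRecord F 2 (TβOfRecord₁₃ F 2) (chiβOfRecord₁₃Ax F 2 θ) K (T4FlagMemory.extd v) j) (fieldMeasure (F.P K) j (SU 2))) ∧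
        (∀ W ∈ domAltOfRecord F 2 θ.ν K (k + 1), UkExists F 2 K (k + 1) θ.εbg W ∧ UniqueUkOrbit F 2 K (k + 1) θ.εbg W)) :
    letI θ := thetaFill F a₀ ε₂₉
    letI := θ.instVβ₁; letI := θ.instVβ₂; letI := θ.instιβ
    (IndexSymmetric (recordPlimAx F a₀ ε₂₉ k v) ∧ B12Beta.PermCovariant (recordPlimAx F a₀ ε₂₉ k v) ∧ ReflCovariant (recordPlimAx F a₀ ε₂₉ k v) ∧
      WardFirst (recordPlimAx F a₀ ε₂₉ k v)) ∧
    ∀ᶠ K in atTop,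
      fderiv ℝ (expChart (recordTermsAx F a₀ ε₂₉ k v K) θ.ρ8) 0 = 0 ∧
      (∀ (μ : Fin (F.P K).d) (x : Site (F.P K) (k + 1)) (ν : Fin (F.P K).d) (y : Site (F.P K) (k + 1)) (i j : θ.ιβ), i ≠ j →
        polComp ℝ (expChart (recordTermsAx F a₀ ε₂₉ k v K) θ.ρ8) θ.bV μ x i ν y j = 0) ∧
      (∀ (μ : Fin (F.P K).d) (x : Site (F.P K) (k + 1)) (ν : Fin (F.P K).d) (y : Site (F.P K) (k + 1)) (i : θ.ιβ),
        polComp ℝ (expChart (recordTermsAx F a₀ ε₂₉ k v K) θ.ρ8) θ.bV μ x i ν y i = polScalar (recordTermsAx F a₀ ε₂₉ k v K) θ.ρ8 θ.bV μ x ν y) ∧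
      (∀ (μ : Fin (F.P K).d) (x : Site (F.P K) (k + 1)) (ν : Fin (F.P K).d) (y a : Site (F.P K) (k + 1)),
        polScalar (recordTermsAx F a₀ ε₂₉ k v K) θ.ρ8 θ.bV μ (x + a) ν (y + a) = polScalar (recordTermsAx F a₀ ε₂₉ k v K) θ.ρ8 θ.bV μ x ν y) := by
  letI θ := thetaFill F a₀ ε₂₉; letI := θ.instVβ₁; letI := θ.instVβ₂; letI := θ.instιβ
  -- the full rows (nestings discharged) at every large `K`
  have hrows' : ∀ᶠ K in atTop, k + 1 ≤ K ∧ ((((F.P K).d * (F.P K).L : ℕ) : ℝ)) ^ 2 / 4 * θ.ν.ε₀ < deltaFed (Fin 2) ∧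
      (∀ j < k + 1, ∀ W ∈ domAltOfRecord F 2 θ.ν K (j + 1), UkExists F 2 K (j + 1) θ.ν.εreg W ∧ UniqueUkOrbit F 2 K (j + 1) θ.ν.εreg W) ∧
      (∀ j < k + 1, ∀ W ∈ domAltOfRecord F 2 θ.ν K (j + 1), critCfgOfRecord F 2 θ.ν K j W ∈ domAltOfRecord F 2 θ.ν K j) ∧
      (∀ j < k + 1, domAltOfRecord F 2 θ.ν K (j + 1) ⊆
        regSetOfRecord F 2 K j (betaInputOfRecord F 2 (TβOfRecord₁₃ F 2) (chiβOfRecord₁₃Ax F 2 θ) K (T4FlagMemory.extd v) j)) ∧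
      (∀ j < k + 1, ∀ᵐ U ∂(fieldMeasure (F.P K) j (SU 2)), (avOfRecord F 2 K j).avg U ∈ domAltOfRecord F 2 θ.ν K (j + 1) →
        U ∉ domAltOfRecord F 2 θ.ν K j → chiβOfRecord₁₃Ax F 2 θ K (T4FlagMemory.extd v) j U = 0) ∧
      (∀ j < k + 1, Integrable (betaInputOfRecord F 2 (TβOfRecord₁₃ F 2) (chiβOfRecord₁₃Ax F 2 θ) K (T4FlagMemory.extd v) j) (fieldMeasure (F.P K) j (SU 2))) ∧
      (∀ W ∈ domAltOfRecord F 2 θ.ν K (k + 1),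
        Averaging.iter (avOfRecord F 2 K) k (Uk F 2 K (k + 1) θ.εbg W) ∈ domAltOfRecord F 2 θ.ν K k ∧
          UkExists F 2 K (k + 1) θ.εbg W ∧ UniqueUkOrbit F 2 K (k + 1) θ.εbg W) := by
    filter_upwards [hrows] with K hK
    obtain ⟨hk, ⟨hFed, hreg3, hreg2, hregε₀, hbg3, hbg2, hbgε₀⟩, h11, hF7a, hsupp, hint, htop⟩ := hK
    obtain ⟨hcrit, htop'⟩ := nestings_of_numerics F θ K k hεreg hreg3 hreg2 hregε₀ hεbg hbg3 hbg2 hbgε₀ h11 htop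
    exact ⟨hk, hFed, h11, hcrit, hF7a, hsupp, hint, htop'⟩
  refine ⟨?_, ?_⟩
  · obtain ⟨hS, hP, hR⟩ := recordPlimAx_symmetries_of_rows F a₀ ε₂₉ k v hε₀ hlim hC2 hrows'
    exact ⟨hS, hP, hR, wardFirst_recordPlimAx_of_rows F a₀ ε₂₉ k v hε₀ hlim hC2
      (hrows'.mono fun _ hK => ⟨hK.1, hK.2.2.1, hK.2.2.2.2.1, hK.2.2.2.2.2.1, hK.2.2.2.2.2.2.1, hK.2.2.2.2.2.2.2⟩)⟩
  · filter_upwards [hC2, hrows'] with K hC hK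
    obtain ⟨hk, -, h11, -, hF7a, hsupp, hint, htop⟩ := hK
    have hN : ∀ (w : GaugeTransf (F.P K) (k + 1) (SU 2)) (W : GaugeField (F.P K) (k + 1) (SU 2)), PlaqSmall θ.ν.ε₀ W →
        mergedTermT F 2 (TβOfRecord₁₃ F 2) (chiβOfRecord₁₃Ax F 2 θ) θ.εbg K (T4FlagMemory.extd v) k (gaugeAct w W) =
          mergedTermT F 2 (TβOfRecord₁₃ F 2) (chiβOfRecord₁₃Ax F 2 θ) θ.εbg K (T4FlagMemory.extd v) k W :=
      fun w W hW => mergedTermT_gaugeAct_recordAx_of_rows F θ θ.εbg K (T4FlagMemory.extd v) hk h11 hF7a hsupp hint htop w W hW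
    have hT : ∀ (a : Site (F.P K) (k + 1)) (W : GaugeField (F.P K) (k + 1) (SU 2)), PlaqSmall θ.ν.ε₀ W →
        mergedTermT F 2 (TβOfRecord₁₃ F 2) (chiβOfRecord₁₃Ax F 2 θ) θ.εbg K (T4FlagMemory.extd v) k (W.translate a) =
          mergedTermT F 2 (TβOfRecord₁₃ F 2) (chiβOfRecord₁₃Ax F 2 θ) θ.εbg K (T4FlagMemory.extd v) k W := by
      intro a W hW
      have hWD : W ∈ domAltOfRecord F 2 θ.ν K (k + 1) := (mem_domAltOfRecord_iff F 2 θ.ν K (k + 1) W).2 hW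
      have hWa : W.translate a ∈ domAltOfRecord F 2 θ.ν K (k + 1) := (translate_mem_domAltOfRecord_iff K θ.ν (k + 1) a W).2 hWD
      exact mergedTermT_translate_on_recordAx θ K (T4FlagMemory.extd v) θ.εbg hk a h11 hF7a hsupp hint hWD (htop W hWD).1 (htop W hWD).2.1 (htop _ hWa).2.2
    exact ⟨fderiv_recordTermsAx_eq_zero_of_local F a₀ ε₂₉ k v K hε₀ (hC.differentiableAt (by norm_num)) hN,
      fun μ x ν y i j hij => polComp_recordTermsAx_offDiag F a₀ ε₂₉ k v K hε₀ (fun u => hN (fun _ => u)) μ x ν y hij,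
      fun μ x ν y i => polComp_recordTermsAx_diag F a₀ ε₂₉ k v K hε₀ (fun u => hN (fun _ => u)) μ x ν y i,
      fun μ x ν y a => polScalar_recordTermsAx_translate_of_local F a₀ ε₂₉ k v K hε₀ hT μ x ν y a⟩

end Summit.QuantumFields.YangMills.Theorems.BalabanUVNodesPortS1

end
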